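import Literature.AnabelianGeometry.EtaleTheta.Discharge.Sec5Lem59vPinGalois
import HarnessLib

/-!
# [EtTh] Lemma 5.9 (v) elementwise — the residual `P`-binding lemmas of abc-iut-w4-d042's `Sec5Lem59vTransport` ON THE v2 SUBQUOTIENT RECORD
# `ThetaSubquotientProjGalois` (proof-only)

Mochizuki, *The étale theta function and its Frobenioid-theoretic manifestations*, Publ. RIMS **45** (2009), Lemma 5.9 (iv)/(v) p. 332 (PDF p. 106)
[cite: MochizukiEtTh2009, Lem 5.9 (v) p.332 (PDF p.106)]; Cor. 2.19 (i) p. 290 (PDF p. 64).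

abc-iut cell, layer L2, seat abc-iut-w6-d079 (gen 6), row «(w4) V1→V2» tranche 1 item (a) (abc-iut-L2-lead g7 R925).  PROOF-ONLY (0 definitions):
the two remaining `P`-binding theorems of abc-iut-w4-d042's `Discharge/Sec5Lem59vTransport.lean` — `biThetaIso_muIncl_rigidity_eq_thetaMod`
and the packaged `exists_biThetaIso_rigidity_of_envIsoBiTheta` — re-run VERBATIM with `(P : ThetaSubquotientProj 𝔉)` replaced by abc-iut-w6-d079's
v2 record `(P : ThetaSubquotientProjGalois 𝔉 Gal)` (p481123) and Prop. 5.5 read on it (`ThetaSubquotientProjGalois.IsKummerDetermined`); the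
elementwise core `biThetaIso_muIncl_rigidity_galois` is in `Sec5Lem59vPinGalois.lean` (p482077).  With this file every `P`-binding statement of the
generic Lemma 5.9 (v) layer (`Sec5Lem59vTransport` / `Sec5Rho219Pin` / `Sec5Rho219PinLaws` / `Sec5Rho219PinKummerShape`) has its v2 twin.

HONEST FRAMING: kernel-checked implications between the cell's typed statements; nothing asserts that such data exist for an actual curve;
[EtTh] is refereed; nothing here bears on [IUTchIII] Cor. 3.12 — no side taken; typed ≠ proved.
-/

noncomputable section

namespace Literature.AnabelianGeometry.EtaleTheta

open CategoryTheory
open FrobenioidCyclotomicRigidity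

universe w v v' u u'

namespace ThetaFrobenioid

variable {C : Type u} [Category.{v} C] {D : Type u'} [Category.{v'} D] (𝔉 : ThetaFrobenioid.{w} C D)
  (h1 : 𝔉.SectionsFactor) (h3 : 𝔉.OuterActionLZ) (hsec : 𝔉.SgpCapSection) (hcs : 𝔉.SgpCupSection)
  (h8 : 𝔉.ConstantsEqNormalizer) (DK : Set (TopOut 𝔉.EPiN)) {Gal : D → Prop}

/-- (v2 record; abc-iut-w4-d042's `biThetaIso_muIncl_rigidity_eq_thetaMod` VERBATIM.) Lemma 5.9 (v) elementwise over a rigidity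
interface `R : RigidData` (L2-t2) for `y` with `ι y ∈ l·Δ_Θ` (automatically
over `Δ`): the common value is `μ(θ-mod(ι y))`, the cyclotomic rigidity identification
`(l·Δ_Θ) ↠ (l·Δ_Θ) ⊗ ℤ/Nℤ ⥲ μ_N` of Cor. 2.19 (i) (`cocycle_lDeltaTheta`).
[cite: MochizukiEtTh2009, Lem 5.9 (v) p.332 (PDF p.106); Cor 2.19 (i) p.290 (PDF p.64)] -/
theorem biThetaIso_muIncl_rigidity_eq_thetaMod_galois {N : ℕ+} {l : ℕ} (R : RigidData.{v} N l) (ι : 𝔉.PiX ≃ₜ* R.PiX)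
    {η : R.PiYdd → R.mu} (hη : η ∈ R.thetaCocycles)
    (i : (𝔉.frdBiThetaEnv h1 h3 hsec hcs h8 DK).Iso (R.toThetaEnvData.modelBi hη))
    (hi : ∀ x : 𝔉.EPiN, ((CycEnvelope.proj R.augY R.chi (i.e x) : R.PiY) : R.PiX) = ι (𝔉.toPiY x))
    (hYdd : 𝔉.PiYdd.map ι.toMonoidHom = R.PiYdd)
    (P : ThetaSubquotientProjGalois 𝔉 Gal) (ρ : RigidityFamily 𝔉) (hB : 𝔉.IsThetaSaturated 𝔉.BN)
    (hρ : P.IsKummerDetermined ρ hB) (y : 𝔉.PiYdd) (hy : ι (y : 𝔉.PiX) ∈ R.lDeltaTheta)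
    (hh : ((𝔉.rhoYdd y : 𝔉.HB) : Aut (𝔉.base.obj 𝔉.BN)) ∈ P.pre (𝔉.base.obj 𝔉.BN)) :
    i.e (𝔉.muIncl (ρ 𝔉.BN hB (QuotientGroup.mk (P.proj _ ⟨_, hh⟩)))) =
      CycEnvelope.inMu R.augY R.chi (R.thetaMod ⟨ι (y : 𝔉.PiX), hy⟩) := by
  have haug : R.aug (ι (y : 𝔉.PiX)) = 1 := (Subgroup.mem_inf.mp (R.lDeltaTheta_le hy)).2
  rw [𝔉.biThetaIso_muIncl_rigidity_galois h1 h3 hsec hcs h8 DK R.toThetaEnvData ι hη i hi hYdd P ρ hB hρ y haug hh,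
    R.cocycle_lDeltaTheta η hη _ hy]

/-! ## Packaged over L2-t4's `EnvIsoBiTheta` -/

/-- (v2 record; abc-iut-w4-d042's `exists_biThetaIso_rigidity_of_envIsoBiTheta` VERBATIM.) **Lemma 5.9 (v) elementwise, from Lemma 5.9 (iv) BY NAME** (`EnvIsoBiTheta`, whose isomorphism is extracted
by choice): there are a cocycle `η` of the collection and an isomorphism of bi-theta environments
`i : E^Π_N ⥲ Π^tp_Y[μ_N]` over `ι` under which, for every `y ∈ Π^tp_Ÿ̲` over `Δ`, the bi-Kummer difference
`s^⊓-Π_N(y) · s^⊔-Π_N(y)⁻¹` goes to `μ(η(ι y))`, and — given Prop. 5.5 BY NAME — so does the Prop. 5.5 rigidity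
isomorphism at `[proj(ρ y)]`. [cite: MochizukiEtTh2009, Lem 5.9 (iv)/(v) p.332 (PDF p.106)] -/
theorem exists_biThetaIso_rigidity_of_envIsoBiTheta_galois {T : ThetaEnvData.{v} 𝔉.N} {ι : 𝔉.PiX ≃ₜ* T.PiX}
    (h59iv : 𝔉.EnvIsoBiTheta h1 h3 hsec hcs h8 DK T ι) (P : ThetaSubquotientProjGalois 𝔉 Gal) (ρ : RigidityFamily 𝔉)
    (hB : 𝔉.IsThetaSaturated 𝔉.BN) (hρ : P.IsKummerDetermined ρ hB) :
    ∃ (η : T.PiYdd → T.mu) (hη : η ∈ T.thetaCocycles)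
      (i : (𝔉.frdBiThetaEnv h1 h3 hsec hcs h8 DK).Iso (T.modelBi hη))
      (hYdd : 𝔉.PiYdd.map ι.toMonoidHom = T.PiYdd),
      (∀ x : 𝔉.EPiN, ((CycEnvelope.proj T.augY T.chi (i.e x) : T.PiY) : T.PiX) = ι (𝔉.toPiY x)) ∧
      (∀ (y : 𝔉.PiYdd) (_ : T.aug (ι (y : 𝔉.PiX)) = 1),
        i.e (𝔉.sCapPi hsec y * (𝔉.sCupPi h1 hcs y)⁻¹) =
          CycEnvelope.inMu T.augY T.chi (η ⟨ι (y : 𝔉.PiX), 𝔉.iota_mem_PiYdd T ι hYdd y⟩)) ∧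
      ∀ (y : 𝔉.PiYdd) (_ : T.aug (ι (y : 𝔉.PiX)) = 1)
        (hh : ((𝔉.rhoYdd y : 𝔉.HB) : Aut (𝔉.base.obj 𝔉.BN)) ∈ P.pre (𝔉.base.obj 𝔉.BN)),
        i.e (𝔉.muIncl (ρ 𝔉.BN hB (QuotientGroup.mk (P.proj _ ⟨_, hh⟩)))) =
          CycEnvelope.inMu T.augY T.chi (η ⟨ι (y : 𝔉.PiX), 𝔉.iota_mem_PiYdd T ι hYdd y⟩) := by
  obtain ⟨-, hYdd, η, hη, i, hi, -⟩ := h59iv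
  exact ⟨η, hη, i, hYdd, hi,
    fun y hy => 𝔉.biThetaIso_sCapPi_mul_sCupPi_inv h1 h3 hsec hcs h8 DK T ι hη i hi hYdd y hy,
    fun y hy hh => 𝔉.biThetaIso_muIncl_rigidity_galois h1 h3 hsec hcs h8 DK T ι hη i hi hYdd P ρ hB hρ y hy hh⟩

end ThetaFrobenioid

end Literature.AnabelianGeometry.EtaleTheta

end
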